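import Summits.Ventures.Crystal3D.Theorems.StickyWulffConstantCoaxialWallLawSealedLedger
import Summits.Ventures.Crystal3D.Theorems.StickyWulffConstantCoaxialWallLawGeneralRung
import HarnessLib

/-!
# The co-axial general-filling rung in the stub's own cell: no clean-sliver hypotheses

HONEST FRAMING. Part of the venture `Summits/Ventures/Crystal3D` (cell `crystal3d-full`), helper
`--supports` the crux `CoaxialWallLaw` (stmt-Ventures-19481, `route-Ventures-StickyWulffConstant`),
REGISTERED line `WallLedgerF` (planner cf-p1 gen 16), stub `stub_coaxialTwoSlabAdhesion`.
`coaxialTwoSlabAdhesion_modulo_foreignCaps_sealed` is `coaxialTwoSlabAdhesion_modulo_foreignCaps`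
(`…CoaxialWallLawGeneralRung`, this seat) with the two clean-sliver hypotheses REMOVED — they are theorems
of the cell on the inner disc (`…CoaxialWallLawSealedCredits`, wulff-p2's sealing) and the ledger has been
rebuilt without them (`coaxial_ledger_ge_faces_add_payers_sealed`).  So, with `KissingGap δ` /
`KissingClassification δ` BY NAME (tree theorems at `δ = 5/2`), for `Λ₁` co-axial with `L` and ANY
`Λ₂ ≠ Λ₁`, in EVERY cell of the stub (ARBITRARY unit-separated filling, nothing else assumed):

  `cross(P₁, X∖P₁) + cross(P₂, Y) ≤ D(Y) + (φ₁ + φ₂ − (√6/11310)·sin θ) π ρ² + #FTC/3770 + C (1 + h) ρ`,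

`FTC` = located in-plane exits of grain 1 that are exact twin caps with a FOREIGN normal `n ≠ ±L e₃`.
`…_sealed_of_coaxial` has literally the quantifier prefix of `stub_coaxialTwoSlabAdhesion`.
Rung credit only; F-C1 not moved.

WHAT THIS IS NOT: not the stub (charge `√6/11310 ≪ ½`, residual `#FTC`); F-C1 not moved.
-/

noncomputable section

namespace Summit.Ventures.Crystal3D.Theorems

open Summit.Ventures.Crystal3D Finset
open Literature.MathematicalPhysics.StatisticalMechanics (fccStacking barlowStacking IsHaggSeq contactDeficiency)
open scoped InnerProductSpace

open scoped Classical in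
/-- **The co-axial general-filling rung modulo the foreign twin caps — sealed form** (the clean-sliver
hypotheses of `coaxialTwoSlabAdhesion_modulo_foreignCaps` removed; otherwise verbatim). -/
theorem coaxialTwoSlabAdhesion_modulo_foreignCaps_sealed {δ : ℝ} (hg : KissingGap δ) (hc : KissingClassification δ)
    (A₁ : EuclideanSpace ℝ (Fin 3) ≃ₗᵢ[ℝ] EuclideanSpace ℝ (Fin 3)) (t₁ : EuclideanSpace ℝ (Fin 3))
    (A₂ : EuclideanSpace ℝ (Fin 3) ≃ₗᵢ[ℝ] EuclideanSpace ℝ (Fin 3)) (t₂ : EuclideanSpace ℝ (Fin 3))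
    (L : EuclideanSpace ℝ (Fin 3) ≃ₗᵢ[ℝ] EuclideanSpace ℝ (Fin 3)) (s₁ : EuclideanSpace ℝ (Fin 3))
    {σ : ℤ → ℤ} (hσ : IsHaggSeq σ)
    (hsub₁ : (fun p => A₁ p + t₁) '' fccStacking 1 (Real.sqrt (2 / 3)) ⊆
      (fun p => L p + s₁) '' barlowStacking 1 (Real.sqrt (2 / 3)) σ)
    (hne : (fun p => A₁ p + t₁) '' fccStacking 1 (Real.sqrt (2 / 3)) ≠
      (fun p => A₂ p + t₂) '' fccStacking 1 (Real.sqrt (2 / 3))) :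
    ∃ w ∈ fccSlots, ⟪A₁ w, L (EuclideanSpace.single (2 : Fin 3) (1 : ℝ))⟫_ℝ = 0 ∧
      0 ≤ ⟪A₁ w, EuclideanSpace.single (2 : Fin 3) (1 : ℝ)⟫_ℝ ∧
    ∃ C R₀ : ℝ, 1 ≤ R₀ ∧ ∀ h : ℝ, 0 ≤ h → ∀ ρ : ℝ, R₀ ≤ ρ →
      ∀ X P₁ P₂ : Finset (EuclideanSpace ℝ (Fin 3)),
      (∀ p ∈ X, ∀ q ∈ X, p ≠ q → 1 ≤ dist p q) → P₁ ⊆ X → P₂ ⊆ X \ P₁ →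
      (∀ p ∈ X, -(2 * R₀) ≤ p 2 ∧ p 2 ≤ h + 2 * R₀ ∧ p 0 ^ 2 + p 1 ^ 2 ≤ ρ ^ 2) →
      (∀ p, p ∈ P₁ ↔ (p ∈ (fun q => A₁ q + t₁) '' fccStacking 1 (Real.sqrt (2 / 3)) ∧
        -(2 * R₀) ≤ p 2 ∧ p 2 ≤ -R₀ ∧ p 0 ^ 2 + p 1 ^ 2 ≤ ρ ^ 2)) →
      (∀ p, p ∈ P₂ ↔ (p ∈ (fun q => A₂ q + t₂) '' fccStacking 1 (Real.sqrt (2 / 3)) ∧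
        h + R₀ ≤ p 2 ∧ p 2 ≤ h + 2 * R₀ ∧ p 0 ^ 2 + p 1 ^ 2 ≤ ρ ^ 2)) →
      ((((P₁ ×ˢ (X \ P₁)).filter fun pq => dist pq.1 pq.2 = 1).card : ℕ) : ℝ) +
        ((((P₂ ×ˢ ((X \ P₁) \ P₂)).filter fun pq => dist pq.1 pq.2 = 1).card : ℕ) : ℝ) ≤
        contactDeficiency ((X \ P₁) \ P₂) +
          (Real.sqrt 2 / 4 * ∑ᶠ w ∈ {w ∈ fccStacking 1 (Real.sqrt (2 / 3)) | ‖w‖ = 1},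
              |⟪w, A₁.symm (EuclideanSpace.single (2 : Fin 3) (1 : ℝ))⟫_ℝ| +
            Real.sqrt 2 / 4 * ∑ᶠ w ∈ {w ∈ fccStacking 1 (Real.sqrt (2 / 3)) | ‖w‖ = 1},
              |⟪w, A₂.symm (EuclideanSpace.single (2 : Fin 3) (1 : ℝ))⟫_ℝ| -
            Real.sqrt 6 / 11310 * Real.sqrt (1 - ⟪L (EuclideanSpace.single (2 : Fin 3) (1 : ℝ)),
              EuclideanSpace.single (2 : Fin 3) (1 : ℝ)⟫_ℝ ^ 2)) * Real.pi * ρ ^ 2 +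
          ((((X.filter fun e => (e ∈ (fun q => A₁ q + t₁) '' fccStacking 1 (Real.sqrt (2 / 3)) ∧
                e 2 < h + R₀ + 2 ∧ e 0 ^ 2 + e 1 ^ 2 ≤ (ρ - 3) ^ 2) ∧
                e - A₁ w ∈ X ∧ (∀ v ∈ fccSlots, e - A₁ w + A₁ v ∈ X) ∧
                ∃ v ∈ fccSlots, e + A₁ v ∉ X).filter fun e => ∃ n : EuclideanSpace ℝ (Fin 3), ‖n‖ = 1 ∧
              n ≠ L (EuclideanSpace.single (2 : Fin 3) (1 : ℝ)) ∧
              n ≠ -L (EuclideanSpace.single (2 : Fin 3) (1 : ℝ)) ∧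
              (∀ v ∈ fccSlots, ⟪A₁ v, n⟫_ℝ = 0 ∨ ⟪A₁ v, n⟫_ℝ = Real.sqrt (2 / 3) ∨
                ⟪A₁ v, n⟫_ℝ = -Real.sqrt (2 / 3)) ∧
              ⟪A₁ w, n⟫_ℝ = Real.sqrt (2 / 3) ∧
              (∀ v ∈ fccSlots, ⟪A₁ v, n⟫_ℝ ≤ 0 → e + A₁ v ∈ X) ∧
              (∀ v ∈ fccSlots, 0 < ⟪A₁ v, n⟫_ℝ → e + A₁ v ∉ X ∧ e - A₁ v + (2 * ⟪A₁ v, n⟫_ℝ) • n ∈ X)).card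
              : ℕ) : ℝ) / 3770 +
          C * (1 + h) * ρ := by
  obtain ⟨w, hw, hw0, hwup, hflux⟩ := exists_inPlane_slot_of_coaxial A₁ t₁ L s₁ hσ hsub₁
  obtain ⟨C₁, hC₁⟩ := affineSampleDeficit_upper A₁ t₁ 10 (by norm_num)
  obtain ⟨C₂, hC₂⟩ := affineSampleDeficit_upper A₂ t₂ 10 (by norm_num)
  refine ⟨w, hw, hw0, hwup, (240 * Real.sqrt 2 * Real.pi + 3120 * (4 * 10 + 2)) / 2 + 2 + |C₁| + |C₂|, 10,
    by norm_num, ?_⟩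
  intro h hh ρ hρ X P₁ P₂ hX hP₁X hP₂X hcell hP₁ hP₂
  set φ₁ : ℝ := Real.sqrt 2 / 4 * ∑ᶠ w ∈ {w ∈ fccStacking 1 (Real.sqrt (2 / 3)) | ‖w‖ = 1},
      |⟪w, A₁.symm (EuclideanSpace.single (2 : Fin 3) (1 : ℝ))⟫_ℝ| with hφ₁
  set φ₂ : ℝ := Real.sqrt 2 / 4 * ∑ᶠ w ∈ {w ∈ fccStacking 1 (Real.sqrt (2 / 3)) | ‖w‖ = 1},
      |⟪w, A₂.symm (EuclideanSpace.single (2 : Fin 3) (1 : ℝ))⟫_ℝ| with hφ₂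
  have hP₂X' : P₂ ⊆ X := hP₂X.trans Finset.sdiff_subset
  have hρ0 : (0 : ℝ) ≤ ρ := by linarith
  -- the three counted families, in the syntactic form of the statement
  set EXS : Finset (EuclideanSpace ℝ (Fin 3)) := X.filter fun e =>
    (e ∈ (fun q => A₁ q + t₁) '' fccStacking 1 (Real.sqrt (2 / 3)) ∧
      e 2 < h + 10 + 2 ∧ e 0 ^ 2 + e 1 ^ 2 ≤ (ρ - 3) ^ 2) ∧
      e - A₁ w ∈ X ∧ (∀ v ∈ fccSlots, e - A₁ w + A₁ v ∈ X) ∧ ∃ v ∈ fccSlots, e + A₁ v ∉ X with hEXS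
  set FTCS : Finset (EuclideanSpace ℝ (Fin 3)) := EXS.filter fun e => ∃ n : EuclideanSpace ℝ (Fin 3), ‖n‖ = 1 ∧
      n ≠ L (EuclideanSpace.single (2 : Fin 3) (1 : ℝ)) ∧
      n ≠ -L (EuclideanSpace.single (2 : Fin 3) (1 : ℝ)) ∧
      (∀ v ∈ fccSlots, ⟪A₁ v, n⟫_ℝ = 0 ∨ ⟪A₁ v, n⟫_ℝ = Real.sqrt (2 / 3) ∨
        ⟪A₁ v, n⟫_ℝ = -Real.sqrt (2 / 3)) ∧
      ⟪A₁ w, n⟫_ℝ = Real.sqrt (2 / 3) ∧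
      (∀ v ∈ fccSlots, ⟪A₁ v, n⟫_ℝ ≤ 0 → e + A₁ v ∈ X) ∧
      (∀ v ∈ fccSlots, 0 < ⟪A₁ v, n⟫_ℝ → e + A₁ v ∉ X ∧ e - A₁ v + (2 * ⟪A₁ v, n⟫_ℝ) • n ∈ X)
    with hFTCS
  set PAYS : Finset (EuclideanSpace ℝ (Fin 3)) := X.filter fun y => (X.filter fun q => dist y q = 1).card ≠ 12 ∧
    ∃ e ∈ X, ((e ∈ (fun q => A₁ q + t₁) '' fccStacking 1 (Real.sqrt (2 / 3)) ∧
        e 2 < h + 10 + 2 ∧ e 0 ^ 2 + e 1 ^ 2 ≤ (ρ - 3) ^ 2) ∧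
        e - A₁ w ∈ X ∧ (∀ v ∈ fccSlots, e - A₁ w + A₁ v ∈ X) ∧ ∃ v ∈ fccSlots, e + A₁ v ∉ X) ∧
      (y = e ∨ dist e y = 1 ∨ (∃ z ∈ X, dist e z = 1 ∧ dist z y = 1) ∨
        ∃ z ∈ X, ∃ z' ∈ X, dist e z = 1 ∧ dist z z' = 1 ∧ dist z' y = 1) with hPAYS
  -- the located exits (predicate `Q` of the restricted machinery): on `Λ₁`, below `h + R₀ + 2`, off the rim
  have hQc : ∀ e ∈ X, (e ∈ (fun q => A₁ q + t₁) '' fccStacking 1 (Real.sqrt (2 / 3)) ∧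
      e 2 < h + 10 + 2 ∧ e 0 ^ 2 + e 1 ^ 2 ≤ (ρ - 3) ^ 2) → e - A₁ w ∈ X →
      (∀ v ∈ fccSlots, e - A₁ w + A₁ v ∈ X) → e 2 < h + 12 := by
    intro e _ hQe _ _
    have := hQe.2.1
    linarith
  -- the ledger with payers
  have hled : 2 * φ₁ * Real.pi * ρ ^ 2 + 2 * φ₂ * Real.pi * ρ ^ 2 + ((PAYS.card : ℕ) : ℝ) -
      (240 * Real.sqrt 2 * Real.pi + 3120 * (4 * 10 + 2)) * (1 + h) * ρ ≤
      ∑ x ∈ X, ((12 : ℝ) - ((X.filter fun q => dist x q = 1).card : ℝ)) := by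
    have h0 := coaxial_ledger_ge_faces_add_payers_sealed A₁ t₁ A₂ t₂ X P₁ P₂ 10 h ρ le_rfl hh hρ hX hcell hP₁X hP₂X'
      hP₁ hP₂ hw hwup (fun e => e ∈ (fun q => A₁ q + t₁) '' fccStacking 1 (Real.sqrt (2 / 3)) ∧
        e 2 < h + 10 + 2 ∧ e 0 ^ 2 + e 1 ^ 2 ≤ (ρ - 3) ^ 2) (h + 12) (by linarith) hQc
    rw [← finsum_unit_fcc_symm_eq_sum_slots A₁, ← finsum_unit_fcc_symm_eq_sum_slots A₂, ← hφ₁, ← hφ₂] at h0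
    convert h0 using 4
  -- sources: the located exits along `w`
  have hEX : Real.sqrt 2 * |⟪A₁ w, EuclideanSpace.single (2 : Fin 3) (1 : ℝ)⟫_ℝ| * Real.pi * (ρ - 1) ^ 2 -
      10 * Real.sqrt 2 * Real.pi * (ρ - 1) - 30 * (h + 4 * 10 + 2) * (2 * ρ - 3) ≤ ((EXS.card : ℕ) : ℝ) := by
    have h0 := card_located_exits_ge A₁ t₁ A₂ t₂ hne X P₁ P₂ 10 h ρ (by norm_num) hh hρ hX hP₁X hP₂X' hcell
      hP₁ hP₂ hw
    convert h0 using 3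
  -- sinks: exits pay or are capped
  have hPAY' : ((EXS.card : ℕ) : ℝ) ≤ ((FTCS.card : ℕ) : ℝ) + 1885 * ((PAYS.card : ℕ) : ℝ) := by
    have h0 := card_exits_le_restrict hg hc hX A₁ hw (fun e =>
      e ∈ (fun q => A₁ q + t₁) '' fccStacking 1 (Real.sqrt (2 / 3)) ∧
        e 2 < h + 10 + 2 ∧ e 0 ^ 2 + e 1 ^ 2 ≤ (ρ - 3) ^ 2)
    rw [filter_twinCapped_eq_foreign_of_inPlane A₁ L X _ hw0] at h0
    have h1 : EXS.card ≤ FTCS.card + 1885 * PAYS.card := by convert h0 using 6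
    exact_mod_cast h1
  -- the flux `f = √2 |⟪A₁ w, e₃⟫| ≥ (√6/3) sin θ` of the in-plane slot, and `f π (ρ−1)² − rim ≥ f π ρ² − 2620 (1+h) ρ`
  set f : ℝ := Real.sqrt 2 * |⟪A₁ w, EuclideanSpace.single (2 : Fin 3) (1 : ℝ)⟫_ℝ| with hf
  set s : ℝ := Real.sqrt (1 - ⟪L (EuclideanSpace.single (2 : Fin 3) (1 : ℝ)),
    EuclideanSpace.single (2 : Fin 3) (1 : ℝ)⟫_ℝ ^ 2) with hs
  have hf0 : 0 ≤ f := by positivity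
  have hs2 : Real.sqrt 2 ≤ 2 := by
    rw [show (2 : ℝ) = Real.sqrt (2 ^ 2) by rw [Real.sqrt_sq (by norm_num)]]
    exact Real.sqrt_le_sqrt (by norm_num)
  have hfle : f ≤ 2 := by
    have h1 := abs_inner_slot_le_one A₁ hw
    have h2 : 0 ≤ Real.sqrt 2 := Real.sqrt_nonneg 2
    calc f = Real.sqrt 2 * |⟪A₁ w, EuclideanSpace.single (2 : Fin 3) (1 : ℝ)⟫_ℝ| := rfl
      _ ≤ 2 * 1 := mul_le_mul hs2 h1 (abs_nonneg _) (by norm_num)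
      _ = 2 := by ring
  have hπ : Real.pi ≤ 4 := Real.pi_le_four
  have hπ0 : 0 ≤ Real.pi := Real.pi_pos.le
  have hsq : 0 ≤ Real.sqrt 2 := Real.sqrt_nonneg 2
  have hflux6 : Real.sqrt 6 * s * Real.pi * ρ ^ 2 ≤ 3 * f * Real.pi * ρ ^ 2 := by
    have h0 : (0 : ℝ) ≤ Real.pi * ρ ^ 2 := by positivity
    have := mul_le_mul_of_nonneg_right hflux h0
    nlinarith only [this]
  have hkey : f * Real.pi * ρ ^ 2 - 2620 * (1 + h) * ρ ≤
      f * Real.pi * (ρ - 1) ^ 2 - 10 * Real.sqrt 2 * Real.pi * (ρ - 1) - 30 * (h + 4 * 10 + 2) * (2 * ρ - 3) := by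
    have e : f * Real.pi * (ρ - 1) ^ 2 - 10 * Real.sqrt 2 * Real.pi * (ρ - 1) -
        30 * (h + 4 * 10 + 2) * (2 * ρ - 3) - (f * Real.pi * ρ ^ 2 - 2620 * (1 + h) * ρ) =
        (2620 * ρ - 2 * (f * Real.pi * ρ) - 10 * (Real.sqrt 2 * Real.pi * ρ) - 2520 * ρ) +
          (2620 * (h * ρ) - 60 * (h * ρ)) + f * Real.pi + 10 * (Real.sqrt 2 * Real.pi) + 90 * h + 3780 := by
      ring
    have h1 : 0 ≤ h * ρ := mul_nonneg hh hρ0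
    have h2 : 0 ≤ Real.sqrt 2 * Real.pi := mul_nonneg hsq hπ0
    have h3 : f * Real.pi * ρ ≤ 8 * ρ := by
      have : f * Real.pi ≤ 8 := by nlinarith only [hfle, hπ, hπ0, hf0]
      exact mul_le_mul_of_nonneg_right this hρ0
    have h4 : Real.sqrt 2 * Real.pi * ρ ≤ 8 * ρ := by
      have : Real.sqrt 2 * Real.pi ≤ 8 := by nlinarith only [hs2, hπ, hπ0, hsq]
      exact mul_le_mul_of_nonneg_right this hρ0
    have h5 : 0 ≤ f * Real.pi := mul_nonneg hf0 hπ0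
    linarith only [e, h1, h2, h3, h4, h5, hh, hρ0]
  -- the two upper slab counts and the two splits
  have hD₁ := hC₁ (-(2 * 10)) (-10) (by ring) ρ hρ P₁ hP₁
  have hD₂ := hC₂ (h + 10) (h + 2 * 10) (by ring) ρ hρ P₂ hP₂
  have hsplit₁ := contactDeficiency_sdiff_split hP₁X
  have hsplit₂ := contactDeficiency_sdiff_split hP₂X
  have htwo := two_mul_contactDeficiency_eq_sum X
  -- constants
  have hb : C₁ * ρ ≤ |C₁| * (1 + h) * ρ := by
    have h1 : 0 ≤ (|C₁| - C₁) * ρ := mul_nonneg (by linarith only [le_abs_self C₁]) hρ0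
    have h2 : 0 ≤ |C₁| * h * ρ := by positivity
    linarith only [h1, h2]
  have hc' : C₂ * ρ ≤ |C₂| * (1 + h) * ρ := by
    have h1 : 0 ≤ (|C₂| - C₂) * ρ := mul_nonneg (by linarith only [le_abs_self C₂]) hρ0
    have h2 : 0 ≤ |C₂| * h * ρ := by positivity
    linarith only [h1, h2]
  have hhρ : 0 ≤ h * ρ := mul_nonneg hh hρ0
  linarith only [hled, hEX, hPAY', hflux6, hkey, hD₁, hD₂, hsplit₁, hsplit₂, htwo, hb, hc', hρ0, hh, hhρ, hπ0]

open scoped Classical in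
/-- **The sealed rung with the crux's quantifier prefix** — EXACTLY the hypotheses and the cell of
`stub_coaxialTwoSlabAdhesion`; distance to the stub: charge `√6/11310` instead of `½` and the residual
`#FTC/3770` of foreign-twin-capped in-plane exits (plus the named inputs `KissingGap δ`,
`KissingClassification δ`, tree theorems at `δ = 5/2` of computational grade). -/
theorem coaxialTwoSlabAdhesion_modulo_foreignCaps_sealed_of_coaxial {δ : ℝ} (hg : KissingGap δ)
    (hc : KissingClassification δ)
    (A₁ : EuclideanSpace ℝ (Fin 3) ≃ₗᵢ[ℝ] EuclideanSpace ℝ (Fin 3)) (t₁ : EuclideanSpace ℝ (Fin 3))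
    (A₂ : EuclideanSpace ℝ (Fin 3) ≃ₗᵢ[ℝ] EuclideanSpace ℝ (Fin 3)) (t₂ : EuclideanSpace ℝ (Fin 3))
    (hcoax : ∃ (L : EuclideanSpace ℝ (Fin 3) ≃ₗᵢ[ℝ] EuclideanSpace ℝ (Fin 3))
        (s₁ s₂ : EuclideanSpace ℝ (Fin 3)) (σ σ' : ℤ → ℤ), IsHaggSeq σ ∧ IsHaggSeq σ' ∧
        (fun p => A₁ p + t₁) '' fccStacking 1 (Real.sqrt (2 / 3)) ⊆
          (fun p => L p + s₁) '' barlowStacking 1 (Real.sqrt (2 / 3)) σ ∧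
        (fun p => A₂ p + t₂) '' fccStacking 1 (Real.sqrt (2 / 3)) ⊆
          (fun p => L p + s₂) '' barlowStacking 1 (Real.sqrt (2 / 3)) σ')
    (hne : (fun p => A₁ p + t₁) '' fccStacking 1 (Real.sqrt (2 / 3)) ≠
      (fun p => A₂ p + t₂) '' fccStacking 1 (Real.sqrt (2 / 3))) :
    ∃ (L : EuclideanSpace ℝ (Fin 3) ≃ₗᵢ[ℝ] EuclideanSpace ℝ (Fin 3))
        (s₁ s₂ : EuclideanSpace ℝ (Fin 3)) (σ σ' : ℤ → ℤ), IsHaggSeq σ ∧ IsHaggSeq σ' ∧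
        (fun p => A₁ p + t₁) '' fccStacking 1 (Real.sqrt (2 / 3)) ⊆
          (fun p => L p + s₁) '' barlowStacking 1 (Real.sqrt (2 / 3)) σ ∧
        (fun p => A₂ p + t₂) '' fccStacking 1 (Real.sqrt (2 / 3)) ⊆
          (fun p => L p + s₂) '' barlowStacking 1 (Real.sqrt (2 / 3)) σ' ∧
    ∃ w ∈ fccSlots, ⟪A₁ w, L (EuclideanSpace.single (2 : Fin 3) (1 : ℝ))⟫_ℝ = 0 ∧
      0 ≤ ⟪A₁ w, EuclideanSpace.single (2 : Fin 3) (1 : ℝ)⟫_ℝ ∧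
    ∃ C R₀ : ℝ, 1 ≤ R₀ ∧ ∀ h : ℝ, 0 ≤ h → ∀ ρ : ℝ, R₀ ≤ ρ →
      ∀ X P₁ P₂ : Finset (EuclideanSpace ℝ (Fin 3)),
      (∀ p ∈ X, ∀ q ∈ X, p ≠ q → 1 ≤ dist p q) → P₁ ⊆ X → P₂ ⊆ X \ P₁ →
      (∀ p ∈ X, -(2 * R₀) ≤ p 2 ∧ p 2 ≤ h + 2 * R₀ ∧ p 0 ^ 2 + p 1 ^ 2 ≤ ρ ^ 2) →
      (∀ p, p ∈ P₁ ↔ (p ∈ (fun q => A₁ q + t₁) '' fccStacking 1 (Real.sqrt (2 / 3)) ∧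
        -(2 * R₀) ≤ p 2 ∧ p 2 ≤ -R₀ ∧ p 0 ^ 2 + p 1 ^ 2 ≤ ρ ^ 2)) →
      (∀ p, p ∈ P₂ ↔ (p ∈ (fun q => A₂ q + t₂) '' fccStacking 1 (Real.sqrt (2 / 3)) ∧
        h + R₀ ≤ p 2 ∧ p 2 ≤ h + 2 * R₀ ∧ p 0 ^ 2 + p 1 ^ 2 ≤ ρ ^ 2)) →
      ((((P₁ ×ˢ (X \ P₁)).filter fun pq => dist pq.1 pq.2 = 1).card : ℕ) : ℝ) +
        ((((P₂ ×ˢ ((X \ P₁) \ P₂)).filter fun pq => dist pq.1 pq.2 = 1).card : ℕ) : ℝ) ≤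
        contactDeficiency ((X \ P₁) \ P₂) +
          (Real.sqrt 2 / 4 * ∑ᶠ w ∈ {w ∈ fccStacking 1 (Real.sqrt (2 / 3)) | ‖w‖ = 1},
              |⟪w, A₁.symm (EuclideanSpace.single (2 : Fin 3) (1 : ℝ))⟫_ℝ| +
            Real.sqrt 2 / 4 * ∑ᶠ w ∈ {w ∈ fccStacking 1 (Real.sqrt (2 / 3)) | ‖w‖ = 1},
              |⟪w, A₂.symm (EuclideanSpace.single (2 : Fin 3) (1 : ℝ))⟫_ℝ| -
            Real.sqrt 6 / 11310 * Real.sqrt (1 - ⟪L (EuclideanSpace.single (2 : Fin 3) (1 : ℝ)),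
              EuclideanSpace.single (2 : Fin 3) (1 : ℝ)⟫_ℝ ^ 2)) * Real.pi * ρ ^ 2 +
          ((((X.filter fun e => (e ∈ (fun q => A₁ q + t₁) '' fccStacking 1 (Real.sqrt (2 / 3)) ∧
                e 2 < h + R₀ + 2 ∧ e 0 ^ 2 + e 1 ^ 2 ≤ (ρ - 3) ^ 2) ∧
                e - A₁ w ∈ X ∧ (∀ v ∈ fccSlots, e - A₁ w + A₁ v ∈ X) ∧
                ∃ v ∈ fccSlots, e + A₁ v ∉ X).filter fun e => ∃ n : EuclideanSpace ℝ (Fin 3), ‖n‖ = 1 ∧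
              n ≠ L (EuclideanSpace.single (2 : Fin 3) (1 : ℝ)) ∧
              n ≠ -L (EuclideanSpace.single (2 : Fin 3) (1 : ℝ)) ∧
              (∀ v ∈ fccSlots, ⟪A₁ v, n⟫_ℝ = 0 ∨ ⟪A₁ v, n⟫_ℝ = Real.sqrt (2 / 3) ∨
                ⟪A₁ v, n⟫_ℝ = -Real.sqrt (2 / 3)) ∧
              ⟪A₁ w, n⟫_ℝ = Real.sqrt (2 / 3) ∧
              (∀ v ∈ fccSlots, ⟪A₁ v, n⟫_ℝ ≤ 0 → e + A₁ v ∈ X) ∧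
              (∀ v ∈ fccSlots, 0 < ⟪A₁ v, n⟫_ℝ → e + A₁ v ∉ X ∧ e - A₁ v + (2 * ⟪A₁ v, n⟫_ℝ) • n ∈ X)).card
              : ℕ) : ℝ) / 3770 +
          C * (1 + h) * ρ := by
  obtain ⟨L, s₁, s₂, σ, σ', hσ, hσ', h₁, h₂⟩ := hcoax
  obtain ⟨w, hw, hw0, hwup, C, R₀, hR₀, key⟩ :=
    coaxialTwoSlabAdhesion_modulo_foreignCaps_sealed hg hc A₁ t₁ A₂ t₂ L s₁ hσ h₁ hne
  exact ⟨L, s₁, s₂, σ, σ', hσ, hσ', h₁, h₂, w, hw, hw0, hwup, C, R₀, hR₀, key⟩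

end Summit.Ventures.Crystal3D.Theorems

end
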